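import Literature.Probability.FitznerVanDerHofstad2017.SrwLawBesselEGF
import Literature.Analysis.FunctionSpaces.BesselJ
import HarnessLib

/-!
# Twisted walk counts: the EGF of `Σ_x (∏_i c(x_i)) · srwCount d m x` is `(Σ_a c(a) I_a(2s))^d`

Companion of `SrwLawBesselEGF.lean` (`hasSum_srwCount_egf`:
`Σ_m srwCount d m x · sᵐ/m! = ∏_i I_{x_i}(2s)`, the Poissonisation identity between (5.3) and (5.4)
of Fitzner–van der Hofstad [FitznerVanDerHofstad2016NoBLE, §5.1.1 pp. 1089–1090], after Hara–Slade
App. B).  For a TWISTED one-coordinate factor — a finite complex combination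
`Φ(v) = Σ_{a ∈ S} c(a) I_a(v)` of modified Bessel functions, e.g. the truncated Bessel row
`Σ_{|j| ≤ J} i^{|j|} J_{|j|}(y) I_{jm}(v)` of the twisted transform `B_m(v,y)/(2π)`
(`SrwTwistBesselRow.lean`, `SrwTwistRowOrderBall.lean`) — the `d`-th power is again an exponential
generating function, now of the TWISTED WALK COUNTS
`t_m := Σ_{x ∈ S^d} (∏_i c(x_i)) · srwCount d m x` (the number of `m`-step nearest-neighbour walks
`0 → x`, weighted by `∏_i c(x_i)` and summed over the endpoints with all coordinates in `S`):

* `hasSum_twistedCount_egf` — **`Σ_m t_m sᵐ/m! = (Σ_{a ∈ S} c(a) I_a(2s))^d`** (every `d`, every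
  finite `S ⊂ ℤ`, every `c : ℤ → ℂ`, every real `s`); `hasSum_twistedCount_egf_half` — the same at
  `s = v/2`: `Σ_m t_m (v/2)ᵐ/m! = Φ(v)^d`;
* `norm_twistedCount_le` — `‖t_m‖ ≤ (2d)^m` when `‖c(a)‖ ≤ 1` on `S` (the twisted Poisson block has
  the plain block's `N`-remainder: `|i^j J_j| ≤ 1`);
* `sum_Icc_neg_eq_sum_range_eps` — folding a symmetric `ℤ`-indexed finite row onto `j ≥ 0` with the
  weights `ε_0 = 1`, `ε_j = 2`, and `sum_image_mul_int` — reindexing `a = j m` (`m ≠ 0`); together they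
  identify `Φ` built from `S = {jm : |j| ≤ J}`, `c(jm) = i^{|j|} J_{|j|}(y)` with the folded partial row
  `Σ_{j ≤ J} ε_j iʲ J_j(y) I_{jm}(v)` of `SrwTwistRowOrderBall.norm_sub_sum_range_le_of_hasSum_besselRow`
  (`besselRow_sum_range_eq_sum_image`, stated verbatim on that partial sum).

Everything is PROVED (standard axioms), `d`-generic and table-free; no definition, no named fact.
Epistemic status / lane: what-if / input-certification SUPPORT — the semantics of the Poisson
(`[0,T]`) block of a twisted-seed kernel certificate (exact Gaussian-rational twisted counts against
`∫₀^T τ^{n+m} e^{-τ} dτ`); nothing here is a certificate and no statement at a specific dimension is made.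

## References
* R. Fitzner, R. van der Hofstad, PTRF 169 (2017) 1041–1119, §5.1.1 (5.3)–(5.5) pp. 1089–1090.
  [FitznerVanDerHofstad2016NoBLE]
* T. Hara, G. Slade, *The lace expansion for self-avoiding walk in five or more dimensions*,
  Rev. Math. Phys. 4 (1992) 235–327, App. B. [HaraSlade1992b]
* NIST DLMF §10.25.2 (series of `I_ν`), §10.35 (generating function). [DLMF]
-/

noncomputable section

open Finset
open scoped Nat

namespace Literature.Probability.FitznerVanDerHofstad2017

open Literature.Probability.LatticeModels (besselI besselI_neg_index)
open Literature.Analysis.FunctionSpaces (besselJ)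
open SrwCount (srwCount srwLaw_eq_srwCount_div)
open Literature.Barriers.CriticalPhenomena.LongRangePhi4 (srwLaw hasSum_srwLaw srwLaw_nonneg)

variable {d : ℕ}

/-- **EGF of the twisted walk counts.** For every finite `S ⊂ ℤ`, `c : ℤ → ℂ` and real `s`,
`Σ_m (Σ_{x ∈ S^d} (∏_i c(x_i)) srwCount d m x) sᵐ/m! = (Σ_{a ∈ S} c(a) I_a(2s))^d`
(expand the `d`-th power over `S^d` and use `Σ_m srwCount d m x sᵐ/m! = ∏_i I_{x_i}(2s)`).
[cite: FitznerVanDerHofstad2016NoBLE, §5.1.1 (5.3)–(5.5) pp. 1089–1090] -/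
theorem hasSum_twistedCount_egf (S : Finset ℤ) (c : ℤ → ℂ) (s : ℝ) :
    HasSum (fun m : ℕ => (∑ x ∈ Fintype.piFinset (fun _ : Fin d => S),
        (∏ i, c (x i)) * (srwCount d m x : ℂ)) * ((s : ℂ) ^ m / (m ! : ℂ)))
      ((∑ a ∈ S, c a * (besselI a (2 * s) : ℂ)) ^ d) := by
  -- one endpoint at a time, complexified
  have hx : ∀ x : Fin d → ℤ, HasSum (fun m : ℕ => (∏ i, c (x i))
      * ((srwCount d m x : ℂ) * ((s : ℂ) ^ m / (m ! : ℂ))))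
      ((∏ i, c (x i)) * (∏ i, (besselI (x i) (2 * s) : ℂ))) := by
    intro x
    have h := Complex.ofRealCLM.hasSum (hasSum_srwCount_egf x s)
    simp only [Complex.ofRealCLM_apply] at h
    push_cast at h
    refine (h.mul_left (∏ i, c (x i))).congr_fun fun m => ?_
    ring
  have hsum := hasSum_sum (s := Fintype.piFinset (fun _ : Fin d => S)) (fun x _ => hx x)
  -- the value: `Σ_x (∏ c(x_i)) ∏ I_{x_i} = (Σ_a c(a) I_a)^d`
  have hval : (∑ x ∈ Fintype.piFinset (fun _ : Fin d => S),
      (∏ i, c (x i)) * (∏ i, (besselI (x i) (2 * s) : ℂ)))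
      = (∑ a ∈ S, c a * (besselI a (2 * s) : ℂ)) ^ d := by
    rw [← Fin.prod_const d (∑ a ∈ S, c a * (besselI a (2 * s) : ℂ)),
      Finset.prod_univ_sum (fun _ : Fin d => S) (fun _ a => c a * (besselI a (2 * s) : ℂ))]
    refine Finset.sum_congr rfl fun x _ => ?_
    rw [Finset.prod_mul_distrib]
  rw [hval] at hsum
  refine hsum.congr_fun fun m => ?_
  rw [Finset.sum_mul]
  refine Finset.sum_congr rfl fun x _ => ?_
  ring

/-- The same at `s = v/2`: `Σ_m t_m (v/2)ᵐ/m! = (Σ_{a ∈ S} c(a) I_a(v))^d`.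
[cite: FitznerVanDerHofstad2016NoBLE, §5.1.1 (5.3)–(5.5) pp. 1089–1090] -/
theorem hasSum_twistedCount_egf_half (S : Finset ℤ) (c : ℤ → ℂ) (v : ℝ) :
    HasSum (fun m : ℕ => (∑ x ∈ Fintype.piFinset (fun _ : Fin d => S),
        (∏ i, c (x i)) * (srwCount d m x : ℂ)) * ((((v / 2 : ℝ)) : ℂ) ^ m / (m ! : ℂ)))
      ((∑ a ∈ S, c a * (besselI a v : ℂ)) ^ d) := by
  have h := hasSum_twistedCount_egf (d := d) S c (v / 2)
  rw [show 2 * (v / 2) = v by ring] at h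
  exact h

/-- **Size of the twisted counts**: if `‖c(a)‖ ≤ 1` on `S` then `‖t_m‖ ≤ (2d)^m` for `1 ≤ d`
(`Σ_x srwCount d m x ≤ (2d)^m`, the total number of `m`-step walks).
[cite: FitznerVanDerHofstad2016NoBLE, §5.1.1 (5.4)–(5.5) pp. 1089–1090] -/
theorem norm_twistedCount_le (hd : 1 ≤ d) {S : Finset ℤ} {c : ℤ → ℂ} (hc : ∀ a ∈ S, ‖c a‖ ≤ 1)
    (m : ℕ) :
    ‖∑ x ∈ Fintype.piFinset (fun _ : Fin d => S), (∏ i, c (x i)) * (srwCount d m x : ℂ)‖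
      ≤ (2 * d : ℝ) ^ m := by
  have hd0 : (0 : ℝ) < (2 * d : ℝ) ^ m := by
    have : (0:ℝ) < d := by exact_mod_cast hd
    positivity
  -- each weight has norm ≤ 1
  have hw : ∀ x ∈ Fintype.piFinset (fun _ : Fin d => S), ‖∏ i, c (x i)‖ ≤ 1 := by
    intro x hx
    rw [norm_prod]
    refine Finset.prod_le_one (fun i _ => norm_nonneg _) (fun i _ => hc _ ?_)
    exact Fintype.mem_piFinset.1 hx i
  -- the plain counts over `S^d` are at most all counts `= (2d)^m Σ_x p_m(x) ≤ (2d)^m`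
  have hcount : ∑ x ∈ Fintype.piFinset (fun _ : Fin d => S), (srwCount d m x : ℝ) ≤ (2 * d : ℝ) ^ m := by
    have hle : ∑ x ∈ Fintype.piFinset (fun _ : Fin d => S), srwLaw d m x ≤ 1 :=
      sum_le_hasSum _ (fun x _ => srwLaw_nonneg m x) (hasSum_srwLaw hd m)
    have heq : ∀ x : Fin d → ℤ, (srwCount d m x : ℝ) = (2 * d : ℝ) ^ m * srwLaw d m x := by
      intro x
      rw [srwLaw_eq_srwCount_div, mul_div_cancel₀ _ hd0.ne']
    simp_rw [heq, ← Finset.mul_sum]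
    calc (2 * d : ℝ) ^ m * ∑ x ∈ Fintype.piFinset (fun _ : Fin d => S), srwLaw d m x
        ≤ (2 * d : ℝ) ^ m * 1 := by gcongr
      _ = (2 * d : ℝ) ^ m := mul_one _
  calc ‖∑ x ∈ Fintype.piFinset (fun _ : Fin d => S), (∏ i, c (x i)) * (srwCount d m x : ℂ)‖
      ≤ ∑ x ∈ Fintype.piFinset (fun _ : Fin d => S), ‖(∏ i, c (x i)) * (srwCount d m x : ℂ)‖ :=
        norm_sum_le _ _
    _ ≤ ∑ x ∈ Fintype.piFinset (fun _ : Fin d => S), (srwCount d m x : ℝ) := by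
        refine Finset.sum_le_sum fun x hx => ?_
        rw [norm_mul, Complex.norm_natCast]
        calc ‖∏ i, c (x i)‖ * (srwCount d m x : ℝ) ≤ 1 * (srwCount d m x : ℝ) := by
              gcongr; exact hw x hx
          _ = (srwCount d m x : ℝ) := one_mul _
    _ ≤ (2 * d : ℝ) ^ m := hcount

/-! ### Folding a symmetric row and reindexing `a = j m` -/

/-- Folding a symmetric finite row: if `f(-j) = f(j)` then
`Σ_{j=-J}^{J} f(j) = Σ_{j=0}^{J} ε_j f(j)` with `ε_0 = 1`, `ε_j = 2` (`j ≥ 1`).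
[cite: DLMF, 10.35.2] -/
theorem sum_Icc_neg_eq_sum_range_eps (f : ℤ → ℂ) (hf : ∀ j : ℤ, f (-j) = f j) (J : ℕ) :
    ∑ j ∈ Finset.Icc (-(J : ℤ)) J, f j
      = ∑ j ∈ Finset.range (J + 1), (if j = 0 then (1 : ℂ) else 2) * f j := by
  induction J with
  | zero => simp
  | succ J ih =>
    -- peel off `± (J+1)`
    have hdecomp : Finset.Icc (-((J + 1 : ℕ) : ℤ)) ((J + 1 : ℕ) : ℤ)
        = insert (-((J + 1 : ℕ) : ℤ)) (insert ((J + 1 : ℕ) : ℤ) (Finset.Icc (-(J : ℤ)) J)) := by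
      ext j
      simp only [Finset.mem_Icc, Finset.mem_insert]
      push_cast
      omega
    have hn1 : -((J + 1 : ℕ) : ℤ) ∉ insert ((J + 1 : ℕ) : ℤ) (Finset.Icc (-(J : ℤ)) J) := by
      simp only [Finset.mem_insert, Finset.mem_Icc]; push_cast; omega
    have hn2 : ((J + 1 : ℕ) : ℤ) ∉ Finset.Icc (-(J : ℤ)) (J : ℤ) := by
      simp only [Finset.mem_Icc]; push_cast; omega
    rw [hdecomp, Finset.sum_insert hn1, Finset.sum_insert hn2, ih, hf,
      Finset.sum_range_succ _ (J + 1), if_neg (Nat.add_one_ne_zero J)]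
    ring

/-- Reindexing along `a = j m` (`m ≠ 0`): `Σ_{a ∈ image (· m) T} g(a) = Σ_{j ∈ T} g(j m)`.
[cite: DLMF, 10.35.2] -/
theorem sum_image_mul_int {m : ℤ} (hm : m ≠ 0) (T : Finset ℤ) (g : ℤ → ℂ) :
    ∑ a ∈ T.image (fun j : ℤ => j * m), g a = ∑ j ∈ T, g (j * m) :=
  Finset.sum_image fun _ _ _ _ h => mul_left_injective₀ hm h

/-- **The folded partial Bessel row is a twisted one-coordinate factor.** With
`S = {j m : |j| ≤ J}` and `c(a) = i^{|a/m|} J_{|a/m|}(y)` (`m ≠ 0`),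
`Σ_{j ≤ J} ε_j I_{jm}(v)·2π iʲ J_j(y) = 2π Σ_{a ∈ S} c(a) I_a(v)` — the partial sums of the folded
Bessel row of `B_m(v,y)` (`SrwTwistBesselRow.hasSum_besselRow_nat_μI`,
`SrwTwistRowOrderBall.norm_sub_sum_range_le_of_hasSum_besselRow`) in the form consumed by
`hasSum_twistedCount_egf_half`. [cite: DLMF, 10.35.2; FitznerVanDerHofstad2016NoBLE, §5.1.1 (5.3)–(5.5)] -/
theorem besselRow_sum_range_eq_sum_image (v y : ℝ) {m : ℤ} (hm : m ≠ 0) (J : ℕ) :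
    ∑ j ∈ Finset.range (J + 1), (if j = 0 then (1 : ℂ) else 2)
        * ((besselI (j * m) v : ℂ) * (2 * Real.pi * Complex.I ^ j * (besselJ j y : ℂ)))
      = 2 * Real.pi * ∑ a ∈ (Finset.Icc (-(J : ℤ)) J).image (fun j : ℤ => j * m),
          (Complex.I ^ (a / m).natAbs * (besselJ (a / m).natAbs y : ℂ)) * (besselI a v : ℂ) := by
  rw [sum_image_mul_int hm, Finset.mul_sum]
  have hdiv : ∀ j : ℤ, j * m / m = j := fun j => Int.mul_ediv_cancel j hm
  simp_rw [hdiv]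
  rw [sum_Icc_neg_eq_sum_range_eps (fun j : ℤ =>
      2 * Real.pi * ((Complex.I ^ j.natAbs * (besselJ j.natAbs y : ℂ)) * (besselI (j * m) v : ℂ)))
      (fun j => by simp only [Int.natAbs_neg, neg_mul, besselI_neg_index]) J]
  refine Finset.sum_congr rfl fun j _ => ?_
  simp only [Int.natAbs_natCast]
  ring

end Literature.Probability.FitznerVanDerHofstad2017

end
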